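import Summits.Ventures.CertifiedArithmetic.LowPrec.DoubleRoundingFMANearWide
import Summits.Ventures.CertifiedArithmetic.LowPrec.DoubleRoundingFMANearWideWitness

/-!
# THEOREM D-fma-W′ as a criterion: the converse, the `iff`, the factor table, the named cells

HONEST FRAMING: certified error envelopes and provably optimal rounding/accumulation schemes for
low-precision formats under stated cost models; every table by two implementations; no hardware
or vendor claims.

`DoubleRoundingFMANearWide.lean` proves `fmaNearWideTest φ ψ → DFma φ ψ` for registers with
`m_ψ = 3 m_φ + 1` (`P_ψ = 3 P_φ - 1`; side conditions of clause F).  Here: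

* §1 THE CONVERSE `not_dFma_of_fmaNearWideTest_eq_false` (with `bias φ ≥ 1` and the range
  hypothesis `hR` of THEOREM D-fma-W): a failing A-test names an available midpoint whose
  significand is composite (the D-fma-W witness `not_dFma_of_sigPairTest`) or whose A2 number is a
  product of two significands (`not_dFma_of_twoSigTest_tie`); a failing B′-test names
  `2^(2P-1) ∓ 1 = a₁·b₁` and a finite second value of the binade `(m+2) ∸ bias`
  (`not_dFma_of_twoSigTest_finer`, frame `k = m + 2 - bias`, `s = 0` when `bias ≤ m + 2`, else
  `k = 0`, `s = bias - m - 2`, the room coming from `hR`).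
* §2 THE CRITERION `dFma_nearWide_iff`: under clause F's side conditions, `m_ψ = 3 m_φ + 1`,
  `m_φ ≥ 1`, `bias φ ≥ 1` and `hR`, `DFma φ ψ ↔ fmaNearWideTest φ ψ`.
* §3 THE FACTOR TABLE of the B′-part, `P = 2, …, 13`: "`2^(2P-1) - 1` or `2^(2P-1) + 1` is a
  product of two `P`-digit numbers" holds for `P ∈ {2, 5, 8}` (`9 = 3·3`, `513 = 19·27`,
  `32767 = 151·217`) and fails for the other `P ≤ 13` (`fmaNearWide_ftable`).  So for FP4-like
  sources (`P = 2`) — which pass EVERY wider register (THEOREM D-fma-W, `5` and `7` prime) — the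
  register `P_ψ = 5` fails as soon as the binade `3 ∸ bias` has a finite second value.
* §4 THE NAMED CELLS: the hypotheses of the criterion hold on `9` cells of the `13 × 13` matrix
  (e2m1 → binary8p5; e3m2, e5m2, binary8p3, binary8p3f → bfloat16; e2m3, e4m3, binary8p4,
  binary8p4f → binary16) and the test agrees with the matrix of `DoubleRoundingFMAMatrix.lean`
  on all of them: e2m1 → binary8p5 and e2m3 → binary16 hold, the `7` others fail
  (`dFmaNearWide_named`, `dFmaNearWide_cells`).  Implementation A =
  `code/enum/fma_nearwide_law.py`, certificate `certs/enum/DOUBLE-ROUNDING-FMA-NEARWIDE.json`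
  (census of all record pairs with `P_φ ≤ 5` in scope: the two implementations agree).

References: [BoldoMelquiond2008] Thm 3; [MartinDorelMelquiondMuller2013] Property 2.1;
[Roux2014] §2; [Figueroa1995] §3.  No hardware or vendor claims.
-/

namespace Summit.Ventures.CertifiedArithmetic

open Literature.ComputerArithmetic.FloatingPoint
open Literature.ComputerArithmetic.FloatingPoint.Format
open Literature.ComputerArithmetic.FloatingPoint.MiniFloat

/-! ## §1 The converse -/

/-- THE CONVERSE OF THEOREM D-fma-W′: for records `φ ⊆ ψ` (`embedsTest`) with `m_ψ = 3 m_φ + 1`,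
`L_ψ ≤ 2 L_φ`, `L_ψ + P_ψ ≤ L_φ`, `m_φ ≥ 1`, `bias φ ≥ 1` and the range hypothesis `hR`, a
failing `fmaNearWideTest` refutes `DFma φ ψ`. [this packet] -/
theorem not_dFma_of_fmaNearWideTest_eq_false {φ ψ : Format} (hE : embedsTest φ ψ = true)
    (hm : ψ.manBits = 3 * φ.manBits + 1) (hq2 : ψ.qexp ≤ 2 * φ.qexp)
    (hnorm : ψ.qexp + ψ.manBits + 1 ≤ φ.qexp) (h1 : 1 ≤ φ.manBits) (hb : 1 ≤ φ.bias)
    (hR : φ.bias + 2 * φ.manBits ≤ ψ.manBits + 1 ∨ 2 ^ (φ.bias + 2 * φ.manBits) ≤ φ.maxScaled)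
    (hW : fmaNearWideTest φ ψ = false) : ¬ DFma φ ψ := by
  have hE' := hE
  simp only [embedsTest, Bool.and_eq_true, decide_eq_true_eq] at hE'
  obtain ⟨⟨-, hq⟩, hM⟩ := hE'
  by_cases hA : fmaNearWideATest φ ψ = true
  · -- the B′-part fails: `2^(2P-1) ∓ 1 = a₁ b₁` and the binade `(m+2) ∸ bias` is available
    have h2 : (fmaNearWideATest φ ψ && fmaNearWideBTest φ) = false := hW
    rw [hA, Bool.true_and] at h2
    unfold fmaNearWideBTest at h2
    simp only [Bool.not_eq_false', Bool.and_eq_true, decide_eq_true_eq] at h2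
    obtain ⟨hT, hRng⟩ := h2
    by_cases hbias : φ.bias ≤ φ.manBits + 2
    · refine not_dFma_of_twoSigTest_finer hq hq2 hM h1 hm hnorm (k := φ.manBits + 2 - φ.bias)
        (s := 0) (by omega) ?_ ?_ hT
      · rw [show φ.manBits + 2 - φ.bias + 1 = φ.manBits + 3 - φ.bias by omega]; exact hRng
      · refine le_trans ?_ hRng
        rw [pow_zero, mul_one, pow_succ]
        exact Nat.mul_le_mul (by omega)
          (Nat.succ_le_of_lt (Nat.one_lt_two_pow (n := φ.manBits + 3 - φ.bias) (by omega)))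
    · have hR' : 2 ^ (φ.bias + 2 * φ.manBits) ≤ φ.maxScaled := by
        rcases hR with hR | hR
        · omega
        · exact hR
      refine not_dFma_of_twoSigTest_finer hq hq2 hM h1 hm hnorm (k := 0)
        (s := φ.bias - φ.manBits - 2) (by omega) ?_ ?_ hT
      · refine le_trans ?_ hR'
        calc (2 ^ φ.manBits + 1) * 2 ^ (0 + 1) ≤ 2 ^ (φ.manBits + 1) * 2 ^ (0 + 1) :=
              Nat.mul_le_mul_right _ (by rw [pow_succ]; have := Nat.one_le_two_pow (n := φ.manBits); omega)
          _ = 2 ^ (φ.manBits + 2) := by rw [← pow_add]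
          _ ≤ 2 ^ (φ.bias + 2 * φ.manBits) := Nat.pow_le_pow_right (by norm_num) (by omega)
      · refine le_trans ?_ hR'
        rw [← pow_add]; exact Nat.pow_le_pow_right (by norm_num) (by omega)
  · -- the A-part fails at an available midpoint `j`
    have hne := hA
    unfold fmaNearWideATest at hne
    rw [List.all_eq_true] at hne
    push Not at hne
    obtain ⟨j, hjm, hj⟩ := hne
    rw [List.mem_range] at hjm
    -- availability: `j < 2^m` and `(2^m + j + 1)·2^(2m+2) ≤ maxScaled` (as in D-fma-W)
    obtain ⟨k, hk⟩ : ∃ k, ψ.manBits = φ.manBits + k := ⟨ψ.manBits - φ.manBits, by omega⟩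
    have htop := φ.topMan_lt
    unfold fmaWideCount at hjm
    by_cases hc1 : φ.manBits + φ.emaxCode ≤ ψ.manBits + 1
    · rw [if_pos hc1] at hjm; exact absurd hjm (Nat.not_lt_zero _)
    rw [if_neg hc1] at hjm
    have hmax : φ.maxScaled = (2 ^ φ.manBits + φ.topMan) * 2 ^ (φ.emaxCode - 1) := by
      unfold Format.maxScaled Format.scaled; rw [if_neg (by omega)]
    have hj2 : j < 2 ^ φ.manBits := by
      by_cases hc2 : φ.manBits + φ.emaxCode = ψ.manBits + 2
      · rw [if_pos hc2] at hjm; omega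
      · rw [if_neg hc2] at hjm; exact hjm
    have hu : (2 ^ φ.manBits + j + 1) * 2 ^ (k + 1) ≤ φ.maxScaled := by
      rw [hmax]
      by_cases hc2 : φ.manBits + φ.emaxCode = ψ.manBits + 2
      · rw [if_pos hc2] at hjm
        rw [show φ.emaxCode - 1 = k + 1 by omega]
        exact Nat.mul_le_mul_right _ (by omega)
      · rw [if_neg hc2] at hjm
        calc (2 ^ φ.manBits + j + 1) * 2 ^ (k + 1)
            ≤ (2 * 2 ^ φ.manBits) * 2 ^ (k + 1) := Nat.mul_le_mul_right _ (by omega)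
          _ = 2 ^ φ.manBits * 2 ^ (k + 2) := by rw [pow_succ 2 (k + 1)]; ring
          _ ≤ 2 ^ φ.manBits * 2 ^ (φ.emaxCode - 1) :=
              Nat.mul_le_mul_left _ (Nat.pow_le_pow_right (by norm_num) (by omega))
          _ ≤ (2 ^ φ.manBits + φ.topMan) * 2 ^ (φ.emaxCode - 1) :=
              Nat.mul_le_mul_right _ (Nat.le_add_right _ _)
    by_cases hs : sigPairTest (φ.manBits + 1) (2 ^ (φ.manBits + 1) + 2 * j + 1) = true
    · exact not_dFma_of_sigPairTest hq hM h1 hb hk (by omega) hR hj2 hu hs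
    · have hw : twoSigTest (φ.manBits + 1) (fmaTieSig φ.manBits (2 ^ φ.manBits + j)) = true := by
        rw [Bool.not_eq_true] at hs
        by_contra hw
        rw [Bool.not_eq_true] at hw
        exact hj (by rw [hs, hw]; rfl)
      rw [show k + 1 = (2 * φ.manBits + 1) + 1 by omega] at hu
      exact not_dFma_of_twoSigTest_tie hq hM h1 hb hm hR hj2 hu hw

/-! ## §2 The criterion -/

/-- THEOREM D-fma-W′ (every pair of format records): `F_φ ⊆ F_ψ`, `m_ψ = 3 m_φ + 1`
(`P_ψ = 3 P_φ - 1`), `bias_φ ≤ bias_ψ`, `L_ψ ≤ 2 L_φ`, `L_ψ + P_ψ ≤ L_φ`, `m_φ ≥ 1`,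
`bias φ ≥ 1` and the range hypothesis `hR` decide the double rounding of the FMA by the record
alone: `DFma φ ψ ↔ fmaNearWideTest φ ψ` — one FMA of `φ`-data in `ψ` converted to `φ` is
correctly rounded for ALL data iff (A) no midpoint of `φ` finite in the binade `2^(P_ψ)` quanta
has a composite significand or a two-significand A2 number, and (B′) not both `2^(2P_φ-1) ∓ 1`
is a product of two significands and the binade `(m_φ+2) ∸ bias_φ` has a finite second value.
Implementation A = `code/enum/fma_nearwide_law.py`. [this packet] -/
theorem dFma_nearWide_iff {φ ψ : Format} (hE : embedsTest φ ψ = true)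
    (hm : ψ.manBits = 3 * φ.manBits + 1) (hbias : φ.bias ≤ ψ.bias)
    (hq2 : ψ.qexp ≤ 2 * φ.qexp) (hnorm : ψ.qexp + ψ.manBits + 1 ≤ φ.qexp) (h1 : 1 ≤ φ.manBits)
    (hb : 1 ≤ φ.bias)
    (hR : φ.bias + 2 * φ.manBits ≤ ψ.manBits + 1 ∨ 2 ^ (φ.bias + 2 * φ.manBits) ≤ φ.maxScaled) :
    DFma φ ψ ↔ fmaNearWideTest φ ψ = true := by
  refine ⟨fun hD => ?_, dFma_of_fmaNearWideTest hE hm hbias hq2 hnorm h1⟩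
  by_contra hW
  exact not_dFma_of_fmaNearWideTest_eq_false hE hm hq2 hnorm h1 hb hR (eq_false_of_ne_true hW) hD

/-! ## §3 The factor table of the B′-part -/

/-- THE FACTOR TABLE, `P = 2, …, 13`: "`2^(2P-1) - 1` or `2^(2P-1) + 1` is a product of two
numbers `< 2^P`" holds exactly for `P ∈ {2, 5, 8}` in this range (`9 = 3·3`, `513 = 19·27`,
`32767 = 151·217`).  Implementation A tabulates `P ≤ 32` (true for
`P ∈ {2, 5, 8, 18, 20, 22, 23, 24, 26, 28, 29, 32}`). [this packet] -/
theorem fmaNearWide_ftable :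
    (List.range 12).map (fun i => (twoSigTest (i + 2) (2 ^ (2 * (i + 2) - 1) - 1)
        || twoSigTest (i + 2) (2 ^ (2 * (i + 2) - 1) + 1)))
      = [true, false, false, true, false, false, true, false, false, false, false, false] := by
  decide +kernel

/-! ## §4 The named records -/

/-- ON THE NAMED `13 × 13` MATRIX the hypotheses of `dFma_nearWide_iff` hold on exactly these
`9` cells, and there the test agrees with the matrix `dFmaPairs` (e2m1 → binary8p5 and
e2m3 → binary16 hold, the `7` others fail).  Implementation A tabulates the same cells.
[this packet] -/
theorem dFmaNearWide_named : ∀ X ∈ namedFormats, ∀ Y ∈ namedFormats,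
    ((embedsTest X Y && decide (Y.manBits = 3 * X.manBits + 1) && decide (X.bias ≤ Y.bias)
      && decide (Y.qexp ≤ 2 * X.qexp) && decide (Y.qexp + Y.manBits + 1 ≤ X.qexp)
      && decide (1 ≤ X.manBits) && decide (1 ≤ X.bias)
      && (decide (X.bias + 2 * X.manBits ≤ Y.manBits + 1)
        || decide (2 ^ (X.bias + 2 * X.manBits) ≤ X.maxScaled))) = true ↔
    (X, Y) ∈ [(E2M1, Binary8p5), (E3M2, BFloat16), (E2M3, Binary16), (E4M3, Binary16),
      (E5M2, BFloat16), (Binary8p3, BFloat16), (Binary8p4, Binary16), (Binary8p3F, BFloat16),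
      (Binary8p4F, Binary16)]) ∧
    ((X, Y) ∈ [(E2M1, Binary8p5), (E3M2, BFloat16), (E2M3, Binary16), (E4M3, Binary16),
      (E5M2, BFloat16), (Binary8p3, BFloat16), (Binary8p4, Binary16), (Binary8p3F, BFloat16),
      (Binary8p4F, Binary16)] →
      (fmaNearWideTest X Y = true ↔ (X, Y) ∈ dFmaPairs)) := by
  decide +kernel

/-- THE `9` NAMED NEAR-WIDE CELLS DECIDED BY THE CRITERION ALONE (no witness search, no window):
`DFma X Y ↔ fmaNearWideTest X Y`, and the test's verdicts (e2m1 → binary8p5, e2m3 → binary16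
hold; the `7` others fail). [this packet] -/
theorem dFmaNearWide_cells : ∀ p ∈ [(E2M1, Binary8p5), (E3M2, BFloat16), (E2M3, Binary16),
      (E4M3, Binary16), (E5M2, BFloat16), (Binary8p3, BFloat16), (Binary8p4, Binary16),
      (Binary8p3F, BFloat16), (Binary8p4F, Binary16)],
    (DFma p.1 p.2 ↔ fmaNearWideTest p.1 p.2 = true) ∧
      (fmaNearWideTest p.1 p.2 = true ↔ p ∈ [(E2M1, Binary8p5), (E2M3, Binary16)]) := by
  have H : ∀ p ∈ [(E2M1, Binary8p5), (E3M2, BFloat16), (E2M3, Binary16),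
      (E4M3, Binary16), (E5M2, BFloat16), (Binary8p3, BFloat16), (Binary8p4, Binary16),
      (Binary8p3F, BFloat16), (Binary8p4F, Binary16)],
      (embedsTest p.1 p.2 && decide (p.2.manBits = 3 * p.1.manBits + 1)
        && decide (p.1.bias ≤ p.2.bias) && decide (p.2.qexp ≤ 2 * p.1.qexp)
        && decide (p.2.qexp + p.2.manBits + 1 ≤ p.1.qexp) && decide (1 ≤ p.1.manBits)
        && decide (1 ≤ p.1.bias)
        && (decide (p.1.bias + 2 * p.1.manBits ≤ p.2.manBits + 1)
          || decide (2 ^ (p.1.bias + 2 * p.1.manBits) ≤ p.1.maxScaled))) = true ∧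
      (fmaNearWideTest p.1 p.2 = true ↔ p ∈ [(E2M1, Binary8p5), (E2M3, Binary16)]) := by
    decide +kernel
  intro p hp
  obtain ⟨h, hv⟩ := H p hp
  simp only [Bool.and_eq_true, Bool.or_eq_true, decide_eq_true_eq] at h
  obtain ⟨⟨⟨⟨⟨⟨⟨hE, hm⟩, hb⟩, hq⟩, hn⟩, h1⟩, hb1⟩, hR⟩ := h
  exact ⟨dFma_nearWide_iff hE hm hb hq hn h1 hb1 hR, hv⟩

end Summit.Ventures.CertifiedArithmetic
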